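import Literature.AlgebraicGeometry.ShimuraVarieties.UnitaryShimuraCanonicalModelNonVacuity
import Literature.NumberTheory.Automorphic.UnitaryGroupFrameHermitian
import Literature.NumberTheory.NumberFields.IdeleStabilizerOfLatticePoints
import Literature.NumberTheory.NumberFields.FiniteIdeleArtinKernel
import HarnessLib

/-!
# The reciprocity factor on the kernel of the Artin map is a global norm-one scalar
# (Shimura reciprocity at CM points, [Milne 2005] Def. 12.8 (62): independence of the Artin correspondent — part 1)

Topic `AlgebraicGeometry/ShimuraVarieties`; namespace `Literature.AlgebraicGeometry.ShimuraVarieties`, grouping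
sub-namespace `UnitaryCanonicalModel` (the carriers `IsArtinCorrespondent`, `recipFactor`, `IsDiagTwist` of the tree's
canonical-model record).  THEOREMS ONLY (no definition, no named fact).  Cell hodgecm-mathlib (D-0151), fan A, KEY
a1-reflex-compositum-model: the idèle passage between reciprocity laws stated with DIFFERENT Artin correspondents of the
same `σ ∈ Aut(ℂ/τL)` (e.g. an `L`-idèle `s` versus the norm `N_{E♯/L} s̃` of an `E♯`-idèle).  HC_CM is proved only
modulo the 7 printed citations until rung 0 closes; nothing here touches them.

WHAT IS PROVED (`L` a CM field, `c` its complex conjugation, `c ⊗ 1` on `𝔸_{L,f}`):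
* §1 `ideleArtinMap_eq_of_isArtinCorrespondent` — two finite idèles `s, s'` that are Artin correspondents of the same
  `σ` (`IsArtinCorrespondent L τ · σ`, each through SOME `L`-embedding `L̄ → ℂ`) have the same Artin symbol
  `[(1_∞,s), L] = [(1_∞,s'), L]` (two embeddings differ by `δ ∈ Gal(L̄/L)`, Mathlib `AlgHom.restrictNormal'`; the
  restrictions of `σ` are then conjugate and agree in `Gal^{ab}`).
* §2 `recipFactor_mul_inv` (`r(s/s') = r(s)·c(r(s'))`, `r(s) = c(s)/s`) and `IsDiagTwist.mul_inv` (the quotient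
  `d·d'⁻¹` of the diagonal twists by `t`, `t'` is the diagonal twist by `t·t''` when `t'·t'' = 1`).
* §3 `exists_recipFactor_eq_algebraMap_of_mem_closure` — **for `k` in the closure of `L^×` in `(𝔸_{L,f})^×`, `r(k) = z ⊗ 1`
  with `z ∈ L`, `z·c(z) = 1`**: `r` is continuous, `r(L^×) ⊆ {z : z c(z) = 1}`, and the diagonal image of the norm-one
  elements is CLOSED (`isClosed_map_unitEmbedding_normOne`: it meets the open subgroup `∏_v 𝓞_v^×` in a finite set by
  KRONECKER — an algebraic integer all of whose conjugates have absolute value `1` lies in a finite set, Mathlib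
  `NumberField.Embeddings.finite_of_norm_le` — so it is a discrete, hence closed, subgroup).
Combined with `…NumberFields.FiniteIdeleArtinKernel` (`[(1,k),L] = 1 ↔ k ∈ closure(L^×)`, [Shimura1998] §18.3) this gives:
for two Artin correspondents `s, s'` of `σ`, `r(s)/r(s') ∈ U(1)(L)` is a GLOBAL norm-one scalar; the geometric consequence
(`[x, r(s)·aK] = [x, r(s')·aK]`) is `…UnitaryShimuraReciprocityTwistInvariance`.

References: [Milne2005ShimuraVarieties] Def. 12.5 p. 113, Def. 12.8 (59)–(62) pp. 107, 114; [Shimura1998] §18.3 p. 122.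
-/

set_option autoImplicit false

noncomputable section

open Function NumberField IsDedekindDomain Matrix
open scoped Matrix
open Literature.NumberTheory.Automorphic Literature.NumberTheory.Automorphic.UnitaryGroup
open Literature.NumberTheory.GaloisRepresentations
open Literature.NumberTheory.NumberFields
open Literature.Geometry.ComplexHyperbolic Literature.Geometry.ComplexHyperbolic.BallModel

namespace Literature.AlgebraicGeometry.ShimuraVarieties

namespace UnitaryCanonicalModel

variable (L : Type) [Field L] [NumberField L] [IsCMField L]

/-! ### §1. Two Artin correspondents of one automorphism have the same Artin symbol -/

omit [IsCMField L] in
/-- **The Artin symbol of an Artin correspondent is determined by `σ`**: if the finite idèles `s` and `s'` of `L`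
both correspond to `σ ∈ Aut(ℂ/τL)` (`IsArtinCorrespondent`: `art_L(s) = σ|_{L^{ab}} = art_L(s')`, each read through
SOME `L`-embedding `L̄ → ℂ`), then `[(1_∞,s), L] = [(1_∞,s'), L]`.  Two `L`-embeddings `e, e' : L̄ → ℂ` differ by
`δ ∈ Gal(L̄/L)` (`e' = e ∘ δ`, Mathlib `AlgHom.restrictNormal'`), so the two restrictions `γ, γ'` of `σ` are conjugate,
`γ' = δ⁻¹ γ δ`, and have the same image in `Gal(L̄/L)^{ab}`. [cite: Milne2005ShimuraVarieties, p. 107 L9–15 and (59)] -/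
theorem ideleArtinMap_eq_of_isArtinCorrespondent (τ : L →+* ℂ) {σ : ℂ ≃+* ℂ}
    {s s' : (FiniteAdeleRing (𝓞 L) L)ˣ} (hs : IsArtinCorrespondent L τ s σ) (hs' : IsArtinCorrespondent L τ s' σ) :
    ideleArtinMap L (Units.map (MonoidHom.inr (InfiniteAdeleRing L) (FiniteAdeleRing (𝓞 L) L) :
        FiniteAdeleRing (𝓞 L) L →* AdeleRing (𝓞 L) L) s) =
      ideleArtinMap L (Units.map (MonoidHom.inr (InfiniteAdeleRing L) (FiniteAdeleRing (𝓞 L) L) :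
        FiniteAdeleRing (𝓞 L) L →* AdeleRing (𝓞 L) L) s') := by
  letI : Algebra L ℂ := τ.toAlgebra
  obtain ⟨e, γ, he, hγ⟩ := hs
  obtain ⟨e', γ', he', hγ'⟩ := hs'
  -- `ℂ` as an `L̄`-algebra through `e`; `δ := e'|` as an automorphism of `L̄` with `e ∘ δ = e'`
  letI : Algebra (AlgebraicClosure L) ℂ := e.toRingHom.toAlgebra
  haveI : IsScalarTower L (AlgebraicClosure L) ℂ :=
    IsScalarTower.of_algebraMap_eq fun x => (e.commutes x).symm
  let δ : AlgebraicClosure L ≃ₐ[L] AlgebraicClosure L := e'.restrictNormal' (AlgebraicClosure L)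
  have hδ : ∀ x, e (δ x) = e' x := fun x => by
    have h := AlgHom.restrictNormal_commutes e' (AlgebraicClosure L) x
    exact h
  -- the two restrictions of `σ` are conjugate under `δ`
  have hconj : ∀ x, δ (Field.absoluteGaloisGroup.toAlgEquiv L γ' x) =
      Field.absoluteGaloisGroup.toAlgEquiv L γ (δ x) := fun x => by
    apply e.injective
    change e (δ (Field.absoluteGaloisGroup.toAlgEquiv L γ' x)) = e (Field.absoluteGaloisGroup.toAlgEquiv L γ (δ x))
    rw [hδ, he', he, hδ]
  let κ : Field.absoluteGaloisGroup L := (Field.absoluteGaloisGroup.toAlgEquiv L).symm δ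
  have hκ : Field.absoluteGaloisGroup.toAlgEquiv L κ = δ := MulEquiv.apply_symm_apply _ _
  have hγγ : γ' = κ⁻¹ * γ * κ := by
    apply (Field.absoluteGaloisGroup.toAlgEquiv L).injective
    rw [map_mul, map_mul, map_inv, hκ]
    ext x
    rw [AlgEquiv.mul_apply, AlgEquiv.mul_apply, AlgEquiv.aut_inv, ← hconj, AlgEquiv.symm_apply_apply]
  have hab : absGaloisAbProj L γ' = absGaloisAbProj L γ := by
    rw [hγγ, map_mul, map_mul, map_inv, mul_comm, ← mul_assoc, mul_inv_cancel, one_mul]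
  rw [ideleArtinMap_apply, ideleArtinMap_apply]
  change (isGlobalReciprocitySystem_artinMap L).theta (finiteIdeleClass L s) =
    (isGlobalReciprocitySystem_artinMap L).theta (finiteIdeleClass L s')
  rw [← _root_.inv_inj, ← hγ, ← hγ', hab]

/-! ### §2. The reciprocity factor and diagonal twists are multiplicative -/

/-- `c ⊗ 1` is an involution on `𝔸_{L,f}`. [folklore] -/
private theorem conjFiniteAdele_conjFiniteAdele (x : FiniteAdeleRing (𝓞 L) L) :
    conjFiniteAdele (↥(maximalRealSubfield L)) L (IsCMField.complexConj L)
      (conjFiniteAdele (↥(maximalRealSubfield L)) L (IsCMField.complexConj L) x) = x := by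
  have hcc : IsCMField.complexConj L * IsCMField.complexConj L = 1 := by
    rw [← pow_two, ← IsCMField.orderOf_complexConj L, pow_orderOf_eq_one]
  rw [conjFiniteAdele_apply, conjFiniteAdele_apply, smul_smul, hcc, one_smul]

/-- **`r(s·s'⁻¹) = r(s) · c(r(s'))`**: the reciprocity factor `r(s) = c(s)/s` is multiplicative and `r(s')⁻¹ = c(r(s'))`
(`r · c(r) = 1`, `recipFactor_mul_conj`). [cite: Milne2005ShimuraVarieties, (60)–(61) p. 114] -/
theorem recipFactor_mul_inv (s s' : (FiniteAdeleRing (𝓞 L) L)ˣ) :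
    recipFactor L (s * s'⁻¹) =
      recipFactor L s * conjFiniteAdele (↥(maximalRealSubfield L)) L (IsCMField.complexConj L) (recipFactor L s') := by
  simp only [recipFactor, Units.val_mul, _root_.mul_inv_rev, inv_inv, map_mul, conjFiniteAdele_conjFiniteAdele]
  ring

variable {L}
variable (H : Matrix (Fin 3) (Fin 3) L)

/-- **Quotient of two diagonal twists**: if `d` twists `v₃` by `t` and `d'` by `t'` with `t' · t'' = 1` (both fixing
`v₃^⊥` pointwise), then `d · d'⁻¹` twists `v₃` by `t · t''`. [cite: Milne2005ShimuraVarieties, Def. 12.5 p. 113] -/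
theorem IsDiagTwist.mul_inv {v₃ : Fin 3 → L} {t t' t'' : FiniteAdeleRing (𝓞 L) L}
    {d d' : finAdelic (↥(maximalRealSubfield L)) L (IsCMField.complexConj L) 3 H}
    (hd : IsDiagTwist L H v₃ t d) (hd' : IsDiagTwist L H v₃ t' d') (ht : t' * t'' = 1) :
    IsDiagTwist L H v₃ (t * t'') (d * d'⁻¹) := by
  obtain ⟨hd1, hd2⟩ := hd
  obtain ⟨hd1', hd2'⟩ := hd'
  set M : Matrix (Fin 3) (Fin 3) (FiniteAdeleRing (𝓞 L) L) :=
    (((d : finAdelic (↥(maximalRealSubfield L)) L (IsCMField.complexConj L) 3 H) :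
      GL (Fin 3) (FiniteAdeleRing (𝓞 L) L)) : Matrix (Fin 3) (Fin 3) (FiniteAdeleRing (𝓞 L) L)) with hM
  set M' : Matrix (Fin 3) (Fin 3) (FiniteAdeleRing (𝓞 L) L) :=
    (((d' : finAdelic (↥(maximalRealSubfield L)) L (IsCMField.complexConj L) 3 H) :
      GL (Fin 3) (FiniteAdeleRing (𝓞 L) L)) : Matrix (Fin 3) (Fin 3) (FiniteAdeleRing (𝓞 L) L)) with hM'
  set N : Matrix (Fin 3) (Fin 3) (FiniteAdeleRing (𝓞 L) L) :=
    ((((d'⁻¹ : finAdelic (↥(maximalRealSubfield L)) L (IsCMField.complexConj L) 3 H) :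
      finAdelic (↥(maximalRealSubfield L)) L (IsCMField.complexConj L) 3 H) :
      GL (Fin 3) (FiniteAdeleRing (𝓞 L) L)) : Matrix (Fin 3) (Fin 3) (FiniteAdeleRing (𝓞 L) L)) with hN
  -- the inverse twist: `d'⁻¹ (v₃ ⊗ 1) = t'' (v₃ ⊗ 1)` and `d'⁻¹` fixes `v₃^⊥`
  have hNM : N * M' = 1 := by
    rw [hN, hM', Subgroup.coe_inv, ← Units.val_mul, inv_mul_cancel, Units.val_one]
  have hinv : ∀ w : Fin 3 → FiniteAdeleRing (𝓞 L) L, N *ᵥ (M' *ᵥ w) = w := fun w => by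
    rw [mulVec_mulVec, hNM, one_mulVec]
  have h1 : N *ᵥ adelicVec L v₃ = t'' • adelicVec L v₃ := by
    have h := hinv (t'' • adelicVec L v₃)
    rw [mulVec_smul, hd1', smul_smul, mul_comm, ht, one_smul] at h
    exact h
  have h2 : ∀ w : Fin 3 → L, hermForm (cmConjRingHom L) H w v₃ = 0 → N *ᵥ adelicVec L w = adelicVec L w := by
    intro w hw
    have h := hinv (adelicVec L w)
    rw [hd2' w hw] at h
    exact h
  have hprod : ((((d * d'⁻¹ : finAdelic (↥(maximalRealSubfield L)) L (IsCMField.complexConj L) 3 H) :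
      finAdelic (↥(maximalRealSubfield L)) L (IsCMField.complexConj L) 3 H) :
      GL (Fin 3) (FiniteAdeleRing (𝓞 L) L)) : Matrix (Fin 3) (Fin 3) (FiniteAdeleRing (𝓞 L) L)) = M * N := by
    rw [Subgroup.coe_mul, Units.val_mul]
  refine ⟨?_, fun w hw => ?_⟩
  · rw [hprod, ← mulVec_mulVec, h1, mulVec_smul, hd1, smul_smul, mul_comm]
  · rw [hprod, ← mulVec_mulVec, h2 w hw, hd2 w hw]


/-! ### §3. On the closure of `L^×` the reciprocity factor is a global norm-one element (Kronecker) -/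

variable (L)

/-- `c ⊗ 1` on a principal adèle: `(c ⊗ 1)(x ⊗ 1) = c(x) ⊗ 1`. [folklore] -/
private theorem conjFiniteAdele_algebraMap' (x : L) :
    conjFiniteAdele (↥(maximalRealSubfield L)) L (IsCMField.complexConj L) (algebraMap L (FiniteAdeleRing (𝓞 L) L) x) =
      algebraMap L (FiniteAdeleRing (𝓞 L) L) (cmConjRingHom L x) := by
  rw [conjFiniteAdele_apply, FiniteAdeleRing.smul_algebraMap, cmConjRingHom_apply, AlgEquiv.smul_def]

/-- **A global element of `L` which is a unit at every finite place and has all conjugates of absolute value `1`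
ranges over a finite set** (Kronecker; Mathlib `NumberField.Embeddings.finite_of_norm_le`): the diagonal image in
`(𝔸_{L,f})^×` of `{z ∈ L^× : z·c(z) = 1}` meets the unit idèles `∏_v 𝓞_v^×` in a finite set — the torus
`T = U(1)_{L/L⁺}` has `T(ℝ) = (S¹)^d` compact, so `T(ℚ)` is discrete in `T(𝔸_f)` ([Milne2005ShimuraVarieties] Thm. 5.26).
[cite: Milne2005ShimuraVarieties, Thm. 5.26 and Example 5.25 p. 64] -/
theorem finite_normOne_inter_unitIdeles :
    (((MonoidHom.id Lˣ * Units.map (cmConjRingHom L : L →* L)).ker.map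
        (FiniteAdeleRing.unitEmbedding (𝓞 L) L) : Subgroup (FiniteAdeleRing (𝓞 L) L)ˣ) ∩
      ((IdeleIdeal.toIdealUnits (𝓞 L) L).ker : Set (FiniteAdeleRing (𝓞 L) L)ˣ) : Set _).Finite := by
  -- the finite set of Kronecker
  have hfin : ((fun z : Lˣ => (z : L)) ⁻¹'
      {x : L | IsIntegral ℤ x ∧ ∀ φ : L →+* ℂ, ‖φ x‖ ≤ 1}).Finite :=
    (NumberField.Embeddings.finite_of_norm_le L ℂ 1).preimage fun _ _ _ _ h => Units.ext h
  refine (hfin.image (FiniteAdeleRing.unitEmbedding (𝓞 L) L)).subset ?_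
  rintro x ⟨⟨z, hz, rfl⟩, hx⟩
  refine ⟨z, ⟨?_, fun φ => ?_⟩, rfl⟩
  · -- a unit at every finite place is an algebraic integer
    have hval : ∀ v : HeightOneSpectrum (𝓞 L), v.valuation L (z : L) ≤ 1 := fun v => by
      have h := (IdeleIdeal.mem_ker_toIdealUnits_iff_valued _).1 hx v
      rw [FiniteAdeleRing.unitEmbedding_apply, FiniteAdeleRing.algebraMap_apply,
        HeightOneSpectrum.valuedAdicCompletion_eq_valuation'] at h
      exact h.le
    obtain ⟨y, hy⟩ := HeightOneSpectrum.mem_integers_of_valuation_le_one L (z : L) hval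
    change IsIntegral ℤ (z : L)
    rw [← hy]
    exact y.isIntegral_coe
  · -- `z · c(z) = 1` forces `|φ z|² = 1`
    have hz1 : (z : L) * cmConjRingHom L z = 1 := by
      have h := Units.ext_iff.1 (MonoidHom.mem_ker.1 hz)
      simpa using h
    have hφ : φ (z : L) * (starRingEnd ℂ) (φ (z : L)) = 1 := by
      rw [← embedding_cmConjRingHom, ← map_mul, hz1, map_one]
    have hn : ‖φ (z : L)‖ ^ 2 = 1 := by
      rw [← Complex.normSq_eq_norm_sq, ← Complex.ofReal_inj, Complex.ofReal_one, ← Complex.mul_conj, hφ]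
    nlinarith [norm_nonneg (φ (z : L))]

/-- **The diagonal image of the norm-one elements `{z ∈ L^× : z·c(z) = 1}` is closed in `(𝔸_{L,f})^×`**: it is a
discrete subgroup (it meets the open subgroup `∏_v 𝓞_v^×` in a finite set, `finite_normOne_inter_unitIdeles`), and
discrete subgroups of Hausdorff groups are closed («`T(ℚ)` is discrete in `T(𝔸_f)` if and only if `T_a(ℝ)` is
compact», here `T = U(1)_{L/L⁺}`). [cite: Milne2005ShimuraVarieties, Thm. 5.26 p. 64] -/
theorem isClosed_map_unitEmbedding_normOne :
    IsClosed ((((MonoidHom.id Lˣ * Units.map (cmConjRingHom L : L →* L)).ker.map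
        (FiniteAdeleRing.unitEmbedding (𝓞 L) L) : Subgroup (FiniteAdeleRing (𝓞 L) L)ˣ) :
      Set (FiniteAdeleRing (𝓞 L) L)ˣ)) := by
  haveI : T2Space (FiniteAdeleRing (𝓞 L) L) := inferInstanceAs <| T2Space
    (RestrictedProduct (fun v : HeightOneSpectrum (𝓞 L) => v.adicCompletion L)
      (fun v => (v.adicCompletionIntegers L : Set (v.adicCompletion L))) Filter.cofinite)
  set D := ((MonoidHom.id Lˣ * Units.map (cmConjRingHom L : L →* L)).ker.map
        (FiniteAdeleRing.unitEmbedding (𝓞 L) L) : Subgroup (FiniteAdeleRing (𝓞 L) L)ˣ) with hD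
  set U := ((IdeleIdeal.toIdealUnits (𝓞 L) L).ker : Subgroup (FiniteAdeleRing (𝓞 L) L)ˣ) with hU
  -- `{1}` is open in `D`: it is the trace of `U ∖ (D ∩ U ∖ {1})`
  have hF : IsClosed (((D : Set (FiniteAdeleRing (𝓞 L) L)ˣ) ∩ (U : Set _)) \ {1}) :=
    ((finite_normOne_inter_unitIdeles L).subset fun _ hx => hx.1).isClosed
  have hopen : IsOpen ((U : Set (FiniteAdeleRing (𝓞 L) L)ˣ) \ (((D : Set _) ∩ (U : Set _)) \ {1})) :=
    IdeleAction.isOpen_ker_toIdealUnits.sdiff hF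
  haveI : DiscreteTopology D := by
    refine discreteTopology_of_isOpen_singleton_one ?_
    have h1 : ((↑) : D → (FiniteAdeleRing (𝓞 L) L)ˣ) ⁻¹'
        ((U : Set (FiniteAdeleRing (𝓞 L) L)ˣ) \ (((D : Set _) ∩ (U : Set _)) \ {1})) = ({1} : Set D) := by
      ext x
      constructor
      · intro hx
        have hxU : (x : (FiniteAdeleRing (𝓞 L) L)ˣ) ∈ (U : Set (FiniteAdeleRing (𝓞 L) L)ˣ) := hx.1
        have hn : (x : (FiniteAdeleRing (𝓞 L) L)ˣ) ∉ (((D : Set _) ∩ (U : Set _)) \ {1}) := hx.2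
        have hx1 : (x : (FiniteAdeleRing (𝓞 L) L)ˣ) = 1 := by
          by_contra hne
          exact hn ⟨⟨x.2, hxU⟩, hne⟩
        exact Set.mem_singleton_iff.2 (Subtype.ext hx1)
      · intro hx
        rw [Set.mem_singleton_iff] at hx
        subst hx
        exact ⟨U.one_mem, fun h => h.2 rfl⟩
    rw [← h1]
    exact hopen.preimage continuous_subtype_val
  exact Subgroup.isClosed_of_discrete

/-- **On the closure of `L^×` in `(𝔸_{L,f})^×` the reciprocity factor `r(k) = c(k)/k` is a GLOBAL norm-one element**:
`r(k) = z ⊗ 1` with `z ∈ L`, `z·c(z) = 1`.  For a principal `k = ℓ` this is `z = c(ℓ)/ℓ`; `r` is continuous and the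
diagonal norm-one elements are closed (`isClosed_map_unitEmbedding_normOne`: `U(1)(L)` is discrete in `U(1)(𝔸_{L,f})`,
[Milne2005ShimuraVarieties] Thm. 5.26).  With [Shimura1998] §18.3 (`ker [·,L] ∩ 𝔸_{L,f}^× = closure(L^×)`) this is
the statement that `r_x` of (60)–(61) kills the kernel of the Artin map modulo `T(ℚ)`.
[cite: Milne2005ShimuraVarieties, Thm. 5.26 p. 64 and (60)–(61) p. 114] [cite: Shimura1998, §18.3 p. 122] -/
theorem exists_recipFactor_eq_algebraMap_of_mem_closure (k : (FiniteAdeleRing (𝓞 L) L)ˣ)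
    (hk : k ∈ closure (Set.range (FiniteAdeleRing.unitEmbedding (𝓞 L) L) : Set (FiniteAdeleRing (𝓞 L) L)ˣ)) :
    ∃ z : L, z * cmConjRingHom L z = 1 ∧ recipFactor L k = algebraMap L (FiniteAdeleRing (𝓞 L) L) z := by
  set c : FiniteAdeleRing (𝓞 L) L →+* FiniteAdeleRing (𝓞 L) L :=
    conjFiniteAdele (↥(maximalRealSubfield L)) L (IsCMField.complexConj L) with hc
  set D := ((MonoidHom.id Lˣ * Units.map (cmConjRingHom L : L →* L)).ker.map
        (FiniteAdeleRing.unitEmbedding (𝓞 L) L) : Subgroup (FiniteAdeleRing (𝓞 L) L)ˣ) with hD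
  -- `r(x) = c(x) x⁻¹` as a continuous self-map of the finite idèle group
  let r : (FiniteAdeleRing (𝓞 L) L)ˣ → (FiniteAdeleRing (𝓞 L) L)ˣ := fun x => Units.map (c : _ →* _) x * x⁻¹
  have hr : Continuous r :=
    ((Continuous.units_map _ (continuous_conjFiniteAdele _ L _)).mul continuous_inv)
  -- `r` maps the principal idèles into `D`
  have hrD : r '' (Set.range (FiniteAdeleRing.unitEmbedding (𝓞 L) L)) ⊆ (D : Set _) := by
    rintro _ ⟨_, ⟨ℓ, rfl⟩, rfl⟩
    refine ⟨Units.map (cmConjRingHom L : L →* L) ℓ * ℓ⁻¹, ?_, ?_⟩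
    · simp only [SetLike.mem_coe, MonoidHom.mem_ker]
      apply Units.ext
      simp only [MonoidHom.mul_apply, MonoidHom.id_apply, Units.val_mul, Units.coe_map, MonoidHom.coe_coe,
        Units.val_one, map_mul, map_units_inv, cmConjRingHom_apply,
        IsCMField.complexConj_apply_apply]
      have hℓ : (ℓ : L) ≠ 0 := ℓ.ne_zero
      have hcℓ : IsCMField.complexConj L (ℓ : L) ≠ 0 := (map_ne_zero _).2 hℓ
      field_simp
      exact Units.mul_inv ℓ
    · apply Units.ext
      simp only [r, map_mul, map_inv, Units.val_mul, Units.coe_map, MonoidHom.coe_coe,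
        FiniteAdeleRing.unitEmbedding_apply, hc, conjFiniteAdele_algebraMap']
  -- hence `r(k) ∈ closure D = D`
  have hmem : r k ∈ (D : Set (FiniteAdeleRing (𝓞 L) L)ˣ) := by
    have h1 : r k ∈ closure (r '' Set.range (FiniteAdeleRing.unitEmbedding (𝓞 L) L)) :=
      image_closure_subset_closure_image hr ⟨k, hk, rfl⟩
    have h2 := closure_mono hrD h1
    rwa [(isClosed_map_unitEmbedding_normOne L).closure_eq] at h2
  obtain ⟨z, hz, hzk⟩ := hmem
  refine ⟨(z : L), ?_, ?_⟩
  · have h := Units.ext_iff.1 (MonoidHom.mem_ker.1 hz)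
    simpa using h
  · have h := congrArg (fun u : (FiniteAdeleRing (𝓞 L) L)ˣ => (u : FiniteAdeleRing (𝓞 L) L)) hzk
    simp only [r, Units.val_mul, Units.coe_map, MonoidHom.coe_coe, FiniteAdeleRing.unitEmbedding_apply] at h
    rw [recipFactor, ← h]


end UnitaryCanonicalModel

end Literature.AlgebraicGeometry.ShimuraVarieties

end
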